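import Literature.Dynamics.NBody.AlbouyKaloshin2012Sec82C

/-!
# Albouy–Kaloshin 2012 §8.2.1: the two factors of the quadratic Euler case on positive masses

[AlbouyKaloshin2012] pp. 573–574: the quadratic 3-body factor "gives two factors,
`(m₄ − m₅)² + (m₅ − m₃)² + (m₃ − m₄)²` and an irreducible factor of degree 12 having only + signs", and the nine
polynomial conditions `L₁ … L₈, L₅′` have "at least one of them being nonzero when the masses are positive".
This file makes the two elementary halves of that sentence kernel-checked on the recomputed tables of
`AlbouyKaloshin2012Sec82C.lean` (two independent engines, certificate `certs/ak82-stdlib` = `certs/ak82-interp`):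

* `AK82_L5_eq` / `AK82_L5_eq_zero_iff`: `2·L₅` is the printed sum of three squares, so the relation `L₅ = 0` of 8.2.1
  holds on a positive triple exactly when `m₃ = m₄ = m₅` — `L₅` DOES have positive zeros (a referee correction of a
  packet note that said otherwise);
* `AK82_L5p_pos`: every one of the 91 coefficients of the recomputed `L₅′` is positive, hence `L₅′ > 0` on positive
  masses — this is the factor with "only + signs", and it is what makes AK's "at least one of them nonzero" true
  (`AK82_not_all_vanish_of_pos`).
[cite: AlbouyKaloshin2012, §8.2.1 pp. 573–574]
-/

namespace Literature.Dynamics.NBody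

/-- `2 L₅ = (m₃ − m₄)² + (m₄ − m₅)² + (m₅ − m₃)²` (the printed form of the quadratic factor, p. 573).
[cite: AlbouyKaloshin2012, p. 573] -/
theorem AK82_L5_eq (m3 m4 m5 : ℝ) :
    2 * AK82_L5 m3 m4 m5 = (m3 - m4) ^ 2 + (m4 - m5) ^ 2 + (m5 - m3) ^ 2 := by
  simp only [AK82_L5, evalTable3, AK82_L5Terms, Term3, List.map, List.sum_cons, List.sum_nil]
  push_cast
  ring

/-- The relation `L₅ = 0` of 8.2.1 holds exactly on `m₃ = m₄ = m₅`; in particular `L₅` has positive zeros.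
[cite: AlbouyKaloshin2012, §8.2.1 p. 574] -/
theorem AK82_L5_eq_zero_iff (m3 m4 m5 : ℝ) :
    AK82_L5 m3 m4 m5 = 0 ↔ m3 = m4 ∧ m4 = m5 := by
  have h := AK82_L5_eq m3 m4 m5
  constructor
  · intro h0
    rw [h0, mul_zero] at h
    constructor <;> nlinarith [sq_nonneg (m3 - m4), sq_nonneg (m4 - m5), sq_nonneg (m5 - m3)]
  · rintro ⟨rfl, rfl⟩
    nlinarith

/-- `Rel821 L₅` on a positive triple is the equal-mass condition. [cite: AlbouyKaloshin2012, §8.2.1 p. 574] -/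
theorem rel821_L5_iff (m : Fin 5 → ℝ) (k l r : Fin 5) :
    Rel821 (fun a b c => AK82_L5 a b c) m k l r ↔ m k = m l ∧ m l = m r := by
  unfold Rel821
  exact AK82_L5_eq_zero_iff _ _ _

/-- The degree-12 factor `L₅′` is positive on positive masses: all 91 recomputed coefficients are positive
("an irreducible factor of degree 12 having only + signs", p. 573). [cite: AlbouyKaloshin2012, p. 573] -/
theorem AK82_L5p_pos {m3 m4 m5 : ℝ} (h3 : 0 < m3) (h4 : 0 < m4) (h5 : 0 < m5) :
    0 < AK82_L5p m3 m4 m5 := by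
  simp only [AK82_L5p, evalTable3, AK82_L5pTerms, Term3, List.map, List.sum_cons, List.sum_nil]
  push_cast
  positivity

/-- AK p. 574: of the nine conditions `L₁ … L₈, L₅′`, "at least one of them being nonzero when the masses are
positive" — witnessed by `L₅′`. [cite: AlbouyKaloshin2012, §8.2.1 p. 574] -/
theorem AK82_not_all_vanish_of_pos {m3 m4 m5 : ℝ} (h3 : 0 < m3) (h4 : 0 < m4) (h5 : 0 < m5) :
    ¬ (AK82_L5 m3 m4 m5 = 0 ∧ AK82_L5p m3 m4 m5 = 0) :=
  fun h => (AK82_L5p_pos h3 h4 h5).ne' h.2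

/-- Sanity: the equal-mass triple is a positive zero of `L₅` (and not of `L₅′`). -/
example : AK82_L5 (1 : ℝ) 1 1 = 0 := (AK82_L5_eq_zero_iff 1 1 1).2 ⟨rfl, rfl⟩

end Literature.Dynamics.NBody
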